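/-
Copyright (c) 2026 the pub-hodgecm-mathlib formalisation cell (harness21).  Prover seat hodgecm-mathlib-LH4-p18 (g0), req620 Track A «(D-RAM) FOUR-FRAME» squad, helper lane on
h413 = stmt-HodgeConjecture-24833 (count-neutral).  β-BOARD v1 (sub-dealer LH4-p05 (g8)) rows R4∕R5: «THE (0 1)-SWAP ENGINE FOR THE LABELLED-ODD STRATUM TABLE».  2026-09-04.
-/
import Summits.HodgeConjecture.HodgeConjecture.Theorems.F0P3cDyRamDiagonalKappaPermutation      -- ★ (LH4-p13 (g3)): brings ★ §P `…DiagonalPermutation` (`mem_mapGL_perm_iff`, `mem_latticeStabilizer_mapGL_perm_iff`, `image_mapGL_stratum`, `coe_conj_eq_diagonal`, `isElementDatum_swap`) and ★ §P₂ `…DiagonalPermutationTwo` (`isVertexLattice_diagonal_mapGL_perm_iff`)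
import Summits.HodgeConjecture.HodgeConjecture.Theorems.F0P3cDyRamLabelledStrataPermutation     -- ★ p859291 (LH4-p09): `latticeInLevel_diagonal_mapGL_perm_iff`
import Summits.HodgeConjecture.HodgeConjecture.Theorems.F0P3cDyRamLabelledOddCountDefs          -- ★ p860257 DEFS (LH4-p11 (g8)): `valueClassLabel`, `polarisationNormClasses`, `classLabelSign`, `labelledOddCount`
import HarnessLib

/-!
# Crux `H413`, line LH4 «(D-RAM) FOUR-FRAME» — (β-BAL) Stage B, THE (0 1)-SWAP ENGINE FOR THE LABELLED-ODD STRATUM TABLE: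
# `Σᶠ_{M ∈ stratum(T, a), shell(e, e₂)} m^Λ_i(M) ∕ [𝒰 : N(S̃(M))] = Σᶠ_{M ∈ stratum(P⁻¹TP, a∘π⁻¹), shell(e∘π⁻¹, e₂∘π⁻¹)} m^{Λ∘P}_{π i}(M) ∕ [𝒰 : N(S̃(M))]`

Cell `hodgecm-mathlib` (D-0151), FLOOR 0, crux item H413 = `stmt-HodgeConjecture-24833`, route `HCCMUnconditional`; squad F0∕P3c∕LH4.  THEOREMS ONLY (no `def`, no instance, no
notation, no `sorry`, default heartbeats); ★-only imports; lane `--supports stmt-HodgeConjecture-24833 --as helper` (count-neutral); pays NO row, states NO law.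

WHY (β-BOARD v1 rows R4∕R5; LH7-p09 (g0) 15:26:32Z «one-shot (0 1)-swap engine»; LH4-p18 (g0) 15:28:35Z (B)).  Every entry of LH4-p05 (g8)'s (β) table has the COMMON SHAPE
`Σᶠ_{M ∈ stratum σ ϖ T a ∧ shell M} labelledOddCount σ ϖ 0 i (valueClassLabel σ ϖ (α−1) (β−1) m* d) M ∕ [𝒰 : N(S̃(M))]`.  The coordinate swap `(0 1)` carries the element
datum `(α, β; n₁, n₂, n₃)` to `(β, α; n₂, n₁, n₃)` (★ `isElementDatum_swap`), the stratum of axis vector `a` of `T = diag(α, β, 1)` onto the stratum of `a ∘ (0 1)` of `diag(β, α, 1)`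
(★ §P `image_mapGL_stratum`), the diagonal shell tokens along (★ p859291), the polarisation classes modulo `N(S̃)` along (`D ↦ D ∘ (0 1)`), the slot `i` to `(0 1) i`, the index
`[𝒰 : N(S̃(M))]` to itself, and — the one new point — the value-class LABEL `valueClassLabel σ ϖ x₀ x₁` to `valueClassLabel σ ϖ x₁ x₀` (the binary norm form is symmetric under the
simultaneous swap of `(x₀, D₀, y₀) ↔ (x₁, D₁, y₁)`).  Hence every `(0 1)`-twin row of the table (R4 = G₂ boundary from R3 = G₁ boundary; the `n₂`-cell half of R5 = G₃ boundary from
the R2 `n₁`-cell column ★ p861290, the G₃ stratum being `(0 1)`-symmetric; later the G₂ κ-class ∕ glue twins) is its partner BY APPLICATION — the labelled-odd twin of ★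
`finsum_kappaCount_mul_stabiliserWeight_stratum_sep_latticeInLevel_swap01_of` (★ `…LabelledKappaStrataPermutation`).
* §1 (any `N`) `mem_unitStabilizer_mapGL_perm_iff`, `mem_map_unitNormMap_unitStabilizer_mapGL_perm_iff`, **`relIndex_map_unitNormMap_unitStabilizer_mapGL_perm`** — `S̃(P·M)`,
  `N(S̃(P·M))` are the re-indexed `S̃(M)`, `N(S̃(M))`, so `[𝒰 : N(S̃(P·M))] = [𝒰 : N(S̃(M))]` (Mathlib `Subgroup.relIndex_comap`).
* §2 (any `π ∈ S₃`, any label) `image_polarisationNormClasses_mapGL_perm`, `classLabelSign_image_comp_perm`, **`labelledOddCount_mapGL_perm`**: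
  `labelledOddCount σ ϖ tv i Λ (P·M) = labelledOddCount σ ϖ tv (π i) (fun M′ D ↦ Λ (P·M′) (D ∘ π)) M`.
* §3 (the swap `(0 1)`) **`valueClassLabel_mapGL_swap01_iff`** ∕ `_eq`: `valueClassLabel σ ϖ x₀ x₁ m d (P·M) (D ∘ (0 1)) ↔ valueClassLabel σ ϖ x₁ x₀ m d M D`.
* §4 HEADS: `finsum_stratum_shell_labelledOdd_div_relIndex_perm` (any `π`, any `Λ`, shell = two levels of one diagonal token and one level of a second);
  **`finsum_stratum_shell_labelledOdd_div_relIndex_swap01`** (the common shape under `(0 1)`: `T = diag(t₀,t₁,t₂) ↦ diag(t₁,t₀,t₂)`, `a ↦ (a₁,a₀,a₂)`, tokens and label slots swapped,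
  `i ↦ (0 1) i`); and the element-datum ADAPTER **`finsum_stratum_shell_labelledOdd_div_relIndex_swap01_of`** (a head of ANY shape at every datum under a side condition `Hyp` with an
  auxiliary witness `w` — e.g. a tower-sign token — gives the `(0 1)`-twin row at `(β, α; n₂, n₁, n₃)`, slot `(0 1) i`).
HONEST LABEL.  Count-neutral transport; sums nothing to a number; R4∕R5∕table∕(β-BAL)∕(β)∕T₊ OPEN; `HC_CM` is proved only modulo the 7 printed citations (2 remaining named inputs:
hLiu418 = `stmt-HodgeConjecture-24832`, h413 = `stmt-HodgeConjecture-24833`) until rung 0 closes.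

## References
* [Kottwitz1986BaseChangeUnits] R. E. Kottwitz, *Base change for unit elements of Hecke algebras*, Compositio Math. 60 (1986), §1 pp. 240–241 (orbital integrals of units as signed
  lattice counts modulo the diagonal torus; symmetry in the coordinates of the split torus).
* [Rogawski1990] J. D. Rogawski, *Automorphic Representations of Unitary Groups in Three Variables*, Ann. of Math. Stud. 123 (1990), §4.9 Prop. 4.9.1 (a)(b) p. 55, §4.10 p. 58.
* [LanglandsShelstad1987] R. P. Langlands, D. Shelstad, *On the definition of transfer factors*, Math. Ann. 278 (1987), §3.
* [Serre1980Trees] J.-P. Serre, *Trees*, Springer (1980), Ch. II §1.1 (lattices and the monomial action).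
-/

set_option autoImplicit false

noncomputable section

namespace Summit.HodgeConjecture.HodgeConjecture.Cruxes.H413.F0P3cDyRamLabelledOddSwapEngine

open Matrix
open Literature.NumberTheory.Automorphic Literature.NumberTheory.Automorphic.HermitianLattice
open Literature.NumberTheory.Automorphic.UnitaryLatticeTree Literature.NumberTheory.Automorphic.UnitaryThreeFourFrame
open Summit.HodgeConjecture.HodgeConjecture.Cruxes.H413.F0P3cDyRamDiagonalTorusDefs
open Summit.HodgeConjecture.HodgeConjecture.Cruxes.H413.F0P3cDyRamDiagonalStrataDefs
open Summit.HodgeConjecture.HodgeConjecture.Cruxes.H413.F0P3cDyRamDiagonalPermutation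
open Summit.HodgeConjecture.HodgeConjecture.Cruxes.H413.F0P3cDyRamDiagonalPermutationTwo
open Summit.HodgeConjecture.HodgeConjecture.Cruxes.H413.F0P3cDyRamFourFrameCensusDefs
open Summit.HodgeConjecture.HodgeConjecture.Cruxes.H413.F0P3cDyRamLabelledStrataPermutation (latticeInLevel_diagonal_mapGL_perm_iff)
open Summit.HodgeConjecture.HodgeConjecture.Cruxes.H413.F0P3cDyRamLabelledOddCountDefs
open scoped Valued WithZero Matrix MatrixGroups

/-! ## §1  The unit stabiliser, its norm image and the index `[𝒰 : N(S̃(M))]` under a coordinate permutation -/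

section Torus

variable {K : Type*} [Field K] [Valued K ℤᵐ⁰] {N : ℕ}

/-- **`u ∈ S̃(P·M) ↔ u ∘ π⁻¹ ∈ S̃(M)`** (★ `mem_latticeStabilizer_mapGL_perm_iff`; the unit torus is permutation-stable). [cite: Kottwitz1986BaseChangeUnits, §1 pp. 240–241] -/
theorem mem_unitStabilizer_mapGL_perm_iff {π : Equiv.Perm (Fin N)} (P : GL (Fin N) K) (hP : (P : Matrix (Fin N) (Fin N) K) = π.permMatrix K)
    (M : Submodule 𝒪[K] (Fin N → K)) (u : Fin N → Kˣ) :
    u ∈ unitStabilizer (mapGL P M) ↔ (fun i => u (π.symm i)) ∈ unitStabilizer M := by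
  rw [F0P3cDyRamDiagonalTorusDefs.unitStabilizer, F0P3cDyRamDiagonalTorusDefs.unitStabilizer, Subgroup.mem_inf, Subgroup.mem_inf,
    mem_latticeStabilizer_mapGL_perm_iff P hP M u, mem_unitTorus_iff, mem_unitTorus_iff]
  constructor
  · rintro ⟨h1, h2⟩
    exact ⟨h1, fun i => h2 (π.symm i)⟩
  · rintro ⟨h1, h2⟩
    refine ⟨h1, fun i => ?_⟩
    have h := h2 (π i)
    rwa [Equiv.symm_apply_apply] at h

/-- **`n ∈ N(S̃(P·M)) ↔ n ∘ π⁻¹ ∈ N(S̃(M))`**: the coordinatewise norm map `z ↦ (z_i σ z_i)_i` commutes with re-indexing. [cite: Kottwitz1986BaseChangeUnits, §1 pp. 240–241]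
[cite: Rogawski1990, §4.9 p. 55] -/
theorem mem_map_unitNormMap_unitStabilizer_mapGL_perm_iff (σ : K →+* K) {π : Equiv.Perm (Fin N)} (P : GL (Fin N) K)
    (hP : (P : Matrix (Fin N) (Fin N) K) = π.permMatrix K) (M : Submodule 𝒪[K] (Fin N → K)) (n : Fin N → Kˣ) :
    n ∈ (unitStabilizer (mapGL P M)).map (unitNormMap σ N) ↔ (fun i => n (π.symm i)) ∈ (unitStabilizer M).map (unitNormMap σ N) := by
  constructor
  · rintro ⟨s, hs, rfl⟩
    exact ⟨fun i => s (π.symm i), (mem_unitStabilizer_mapGL_perm_iff P hP M s).1 hs, funext fun i => rfl⟩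
  · rintro ⟨s', hs', h⟩
    refine ⟨fun i => s' (π i), (mem_unitStabilizer_mapGL_perm_iff P hP M _).2 ?_, ?_⟩
    · have e : (fun i => (fun j => s' (π j)) (π.symm i)) = s' := funext fun i => by simp only [Equiv.apply_symm_apply]
      rw [e]
      exact hs'
    · funext i
      have hi := congrFun h (π i)
      simp only [Equiv.symm_apply_apply] at hi
      rw [← hi]
      rfl

/-- **`[𝒰 : N(S̃(P·M))] = [𝒰 : N(S̃(M))]`** — `N(S̃(P·M))` is the preimage of `N(S̃(M))` under the automorphism `u ↦ u ∘ π⁻¹` of `(K^×)^N`, which maps `𝒰` onto itself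
(Mathlib `Subgroup.relIndex_comap`; twin of ★ `stabiliserWeight_mapGL_perm`). [cite: Kottwitz1986BaseChangeUnits, §1 pp. 240–241] [cite: Rogawski1990, §4.9 Prop. 4.9.1 (a) p. 55] -/
theorem relIndex_map_unitNormMap_unitStabilizer_mapGL_perm (σ : K →+* K) {π : Equiv.Perm (Fin N)} (P : GL (Fin N) K)
    (hP : (P : Matrix (Fin N) (Fin N) K) = π.permMatrix K) (M : Submodule 𝒪[K] (Fin N → K)) :
    ((unitStabilizer (mapGL P M)).map (unitNormMap σ N)).relIndex (fixedUnitTorus σ N) = ((unitStabilizer M).map (unitNormMap σ N)).relIndex (fixedUnitTorus σ N) := by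
  -- the re-indexing homomorphism `φ u = u ∘ π⁻¹`
  set φ : (Fin N → Kˣ) →* (Fin N → Kˣ) := MonoidHom.pi fun i => Pi.evalMonoidHom (fun _ : Fin N => Kˣ) (π.symm i) with hφ
  have hφ_apply : ∀ u i, φ u i = u (π.symm i) := fun u i => rfl
  have hsurj : ∀ w : Fin N → Kˣ, φ (fun i => w (π i)) = w := fun w => by
    funext i; rw [hφ_apply]; simp
  have hN : (unitStabilizer (mapGL P M)).map (unitNormMap σ N) = ((unitStabilizer M).map (unitNormMap σ N)).comap φ := by
    ext n
    rw [Subgroup.mem_comap, mem_map_unitNormMap_unitStabilizer_mapGL_perm_iff σ P hP M n]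
    rfl
  have hU : (fixedUnitTorus σ N).map φ = fixedUnitTorus σ N := by
    ext w
    constructor
    · rintro ⟨u, hu, rfl⟩
      rw [SetLike.mem_coe, mem_fixedUnitTorus_iff] at hu
      exact (mem_fixedUnitTorus_iff σ _).2 ⟨fun i => hu.1 (π.symm i), fun i => hu.2 (π.symm i)⟩
    · intro hw
      rw [mem_fixedUnitTorus_iff] at hw
      exact ⟨fun i => w (π i), (mem_fixedUnitTorus_iff σ _).2 ⟨fun i => hw.1 (π i), fun i => hw.2 (π i)⟩, hsurj w⟩
  rw [hN, Subgroup.relIndex_comap, hU]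

end Torus

/-! ## §2  The polarisation classes modulo `N(S̃)`, the signed label of a class, and the labelled odd count under a coordinate permutation -/

section Classes

variable {K : Type} [Field K] [Valued K ℤᵐ⁰]

/-- **THE CLASSES MODULO `N(S̃)` OF `P·M` ARE THE RE-INDEXED CLASSES OF `M`**: `C ↦ {D ∘ π⁻¹ | D ∈ C}` maps `polarisationNormClasses σ ϖ tv (P·M)` onto
`polarisationNormClasses σ ϖ tv M` (★ §P₂ `isVertexLattice_diagonal_mapGL_perm_iff`: polarisations correspond under `D ↦ D ∘ π⁻¹`; §1: so do the norm images of the unit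
stabilisers; twin of ★ `image_polarisationCosets_mapGL_perm`). [cite: Kottwitz1986BaseChangeUnits, §1 pp. 240–241] [cite: Rogawski1990, §4.9 Prop. 4.9.1 (a) p. 55] -/
theorem image_polarisationNormClasses_mapGL_perm (σ : K →+* K) (ϖ : K) {π : Equiv.Perm (Fin 3)} (P : GL (Fin 3) K)
    (hP : (P : Matrix (Fin 3) (Fin 3) K) = π.permMatrix K) (tv : ℕ) (M : Submodule 𝒪[K] (Fin 3 → K)) :
    (fun C : Set (Fin 3 → K) => (fun D : Fin 3 → K => D ∘ ⇑π.symm) '' C) '' polarisationNormClasses σ ϖ tv (mapGL P M) = polarisationNormClasses σ ϖ tv M := by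
  -- the class of `D` for `P·M` is carried to the class of `D ∘ π⁻¹` for `M`
  have hcoset : ∀ D : Fin 3 → K, (fun D' : Fin 3 → K => D' ∘ ⇑π.symm) ''
      {D' : Fin 3 → K | ∃ n ∈ (unitStabilizer (mapGL P M)).map (unitNormMap σ 3), ∀ i, D' i = D i * ((n i : Kˣ) : K)} =
      {D' : Fin 3 → K | ∃ n ∈ (unitStabilizer M).map (unitNormMap σ 3), ∀ i, D' i = (D ∘ ⇑π.symm) i * ((n i : Kˣ) : K)} := by
    intro D
    ext E
    constructor
    · rintro ⟨D', ⟨n, hn, hD'⟩, rfl⟩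
      exact ⟨fun i => n (π.symm i), (mem_map_unitNormMap_unitStabilizer_mapGL_perm_iff σ P hP M n).1 hn, fun i => hD' (π.symm i)⟩
    · rintro ⟨m, hm, hE⟩
      refine ⟨fun i => D i * ((m (π i) : Kˣ) : K), ⟨fun i => m (π i), (mem_map_unitNormMap_unitStabilizer_mapGL_perm_iff σ P hP M _).2 ?_, fun i => rfl⟩, ?_⟩
      · have e : (fun i => (fun j => m (π j)) (π.symm i)) = m := funext fun i => by simp only [Equiv.apply_symm_apply]
        rw [e]
        exact hm
      · funext i
        simp only [Function.comp_apply, Equiv.apply_symm_apply]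
        exact (hE i).symm
  ext C
  simp only [Set.mem_image, mem_polarisationNormClasses_iff]
  constructor
  · rintro ⟨C', ⟨D, ⟨hD, hV⟩, rfl⟩, rfl⟩
    exact ⟨D ∘ ⇑π.symm, ⟨fun i => hD (π.symm i), (isVertexLattice_diagonal_mapGL_perm_iff σ ϖ P hP D tv M).1 hV⟩, hcoset D⟩
  · rintro ⟨D, ⟨hD, hV⟩, rfl⟩
    have e : (D ∘ ⇑π) ∘ ⇑π.symm = D := by rw [Function.comp_assoc, Equiv.self_comp_symm, Function.comp_id]
    refine ⟨{D' : Fin 3 → K | ∃ n ∈ (unitStabilizer (mapGL P M)).map (unitNormMap σ 3), ∀ i, D' i = (D ∘ ⇑π) i * ((n i : Kˣ) : K)},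
      ⟨D ∘ ⇑π, ⟨fun i => hD (π i), (isVertexLattice_diagonal_mapGL_perm_iff σ ϖ P hP (D ∘ ⇑π) tv M).2 (by rw [e]; exact hV)⟩, rfl⟩, ?_⟩
    rw [hcoset (D ∘ ⇑π), e]

omit [Valued K ℤᵐ⁰] in
/-- **THE SIGNED LABEL OF A RE-INDEXED SET OF FORMS**: `classLabelSign σ i Q ((· ∘ π) '' C) = classLabelSign σ (π i) (fun D ↦ Q (D ∘ π)) C` (the label and the slot-`i` norm sign of
`D ∘ π` are the re-indexed label and the slot-`π i` norm sign of `D`; twin of ★ `cosetKappa_image_comp_perm`). [cite: LanglandsShelstad1987, §3] [cite: Kottwitz1986BaseChangeUnits, §1 pp. 240–241] -/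
theorem classLabelSign_image_comp_perm (σ : K →+* K) (π : Equiv.Perm (Fin 3)) (i : Fin 3) (Q : (Fin 3 → K) → Prop) (C : Set (Fin 3 → K)) :
    classLabelSign σ i Q ((fun D : Fin 3 → K => D ∘ ⇑π) '' C) = classLabelSign σ (π i) (fun D => Q (D ∘ ⇑π)) C := by
  have hall : ∀ e : ℤ, (∀ E ∈ (fun D : Fin 3 → K => D ∘ ⇑π) '' C, Q E ∧ normSign σ (E i) = e) ↔ ∀ D ∈ C, Q (D ∘ ⇑π) ∧ normSign σ (D (π i)) = e := by
    intro e
    constructor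
    · intro h D hD
      exact h _ ⟨D, hD, rfl⟩
    · rintro h E ⟨D, hD, rfl⟩
      exact h D hD
  rw [classLabelSign_eq, classLabelSign_eq]
  by_cases h1 : ∀ D ∈ C, Q (D ∘ ⇑π) ∧ normSign σ (D (π i)) = 1
  · rw [if_pos ((hall 1).2 h1), if_pos h1]
  · rw [if_neg (fun h => h1 ((hall 1).1 h)), if_neg h1]
    by_cases h2 : ∀ D ∈ C, Q (D ∘ ⇑π) ∧ normSign σ (D (π i)) = -1
    · rw [if_pos ((hall (-1)).2 h2), if_pos h2]
    · rw [if_neg (fun h => h2 ((hall (-1)).1 h)), if_neg h2]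

/-- **`labelledOddCount` UNDER A COORDINATE PERMUTATION** (any type `tv`, any label `Λ`, any `π ∈ S₃`, `P` the matrix of `π`):
`labelledOddCount σ ϖ tv i Λ (P·M) = labelledOddCount σ ϖ tv (π i) (fun M′ D ↦ Λ (P·M′) (D ∘ π)) M` — the classes of `M` are the re-indexed classes of `P·M` (`image_polarisationNormClasses_mapGL_perm`)
and the signed label moves with the slot (`classLabelSign_image_comp_perm` at `π⁻¹`); twin of ★ `kappaCount_mapGL_perm`. [cite: Kottwitz1986BaseChangeUnits, §1 pp. 240–241]
[cite: LanglandsShelstad1987, §3] [cite: Rogawski1990, §4.9 Prop. 4.9.1 (a)(b) p. 55] -/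
theorem labelledOddCount_mapGL_perm (σ : K →+* K) (ϖ : K) {π : Equiv.Perm (Fin 3)} (P : GL (Fin 3) K)
    (hP : (P : Matrix (Fin 3) (Fin 3) K) = π.permMatrix K) (tv : ℕ) (i : Fin 3) (Λ : Submodule 𝒪[K] (Fin 3 → K) → (Fin 3 → K) → Prop)
    (M : Submodule 𝒪[K] (Fin 3 → K)) :
    labelledOddCount σ ϖ tv i Λ (mapGL P M) = labelledOddCount σ ϖ tv (π i) (fun M' D => Λ (mapGL P M') (D ∘ ⇑π)) M := by
  have hinj : Function.Injective (fun D : Fin 3 → K => D ∘ ⇑π.symm) := fun D₁ D₂ h => by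
    have h' := congrArg (fun E : Fin 3 → K => E ∘ ⇑π) h
    simpa only [Function.comp_assoc, Equiv.symm_comp_self, Function.comp_id] using h'
  rw [labelledOddCount_eq, labelledOddCount_eq, ← image_polarisationNormClasses_mapGL_perm σ ϖ P hP tv M,
    finsum_mem_image (Set.image_injective.2 hinj).injOn]
  refine finsum_mem_congr rfl fun C _ => ?_
  rw [classLabelSign_image_comp_perm σ π.symm (π i) _ C, Equiv.symm_apply_apply]
  have e : (fun D : Fin 3 → K => (fun D' : Fin 3 → K => Λ (mapGL P M) (D' ∘ ⇑π)) (D ∘ ⇑π.symm)) = Λ (mapGL P M) := funext fun D => by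
    simp only [Function.comp_assoc, Equiv.symm_comp_self, Function.comp_id]
  rw [e]

/-- **THE TABLE SUMMAND UNDER A COORDINATE PERMUTATION**: `m^Λ_i(P·M) ∕ [𝒰 : N(S̃(P·M))] = m^{Λ∘P}_{π i}(M) ∕ [𝒰 : N(S̃(M))]` (§1 + `labelledOddCount_mapGL_perm`).
[cite: Kottwitz1986BaseChangeUnits, §1 pp. 240–241] [cite: Rogawski1990, §4.9 Prop. 4.9.1 (a)(b) p. 55] -/
theorem labelledOddCount_div_relIndex_mapGL_perm (σ : K →+* K) (ϖ : K) {π : Equiv.Perm (Fin 3)} (P : GL (Fin 3) K)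
    (hP : (P : Matrix (Fin 3) (Fin 3) K) = π.permMatrix K) (tv : ℕ) (i : Fin 3) (Λ : Submodule 𝒪[K] (Fin 3 → K) → (Fin 3 → K) → Prop)
    (M : Submodule 𝒪[K] (Fin 3 → K)) :
    (labelledOddCount σ ϖ tv i Λ (mapGL P M) : ℚ) / ((((unitStabilizer (mapGL P M)).map (unitNormMap σ 3)).relIndex (fixedUnitTorus σ 3) : ℕ) : ℚ) =
      (labelledOddCount σ ϖ tv (π i) (fun M' D => Λ (mapGL P M') (D ∘ ⇑π)) M : ℚ) /
        ((((unitStabilizer M).map (unitNormMap σ 3)).relIndex (fixedUnitTorus σ 3) : ℕ) : ℚ) := by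
  rw [labelledOddCount_mapGL_perm σ ϖ P hP tv i Λ M, relIndex_map_unitNormMap_unitStabilizer_mapGL_perm σ P hP M]

end Classes

/-! ## §3  The value-class label of record under the swap `(0 1)`: the two slots of the binary norm form are exchanged -/

section Label

variable {K : Type} [Field K] [Valued K ℤᵐ⁰]

omit [Valued K ℤᵐ⁰] in
/-- The binary norm form re-indexed by `(0 1)`: `D_{(01)0}·x₀·N(y_{(01)0}) + D_{(01)1}·x₁·N(y_{(01)1}) = D₀·x₁·N(y₀) + D₁·x₀·N(y₁)`.
[cite: Rogawski1990, §4.9 Prop. 4.9.1 (b) p. 55] -/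
theorem binaryNormForm_comp_swap01 (σ : K →+* K) (x₀ x₁ : K) (D y : Fin 3 → K) :
    (D ∘ ⇑(Equiv.swap (0 : Fin 3) 1)) 0 * x₀ * ((y ∘ ⇑(Equiv.swap (0 : Fin 3) 1)) 0 * σ ((y ∘ ⇑(Equiv.swap (0 : Fin 3) 1)) 0)) +
        (D ∘ ⇑(Equiv.swap (0 : Fin 3) 1)) 1 * x₁ * ((y ∘ ⇑(Equiv.swap (0 : Fin 3) 1)) 1 * σ ((y ∘ ⇑(Equiv.swap (0 : Fin 3) 1)) 1)) =
      D 0 * x₁ * (y 0 * σ (y 0)) + D 1 * x₀ * (y 1 * σ (y 1)) := by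
  simp only [Function.comp_apply, Equiv.swap_apply_left, Equiv.swap_apply_right]
  ring

/-- **THE VALUE-CLASS LABEL UNDER `(0 1)`**: for `P` the matrix of the swap `(0 1)`,
`valueClassLabel σ ϖ x₀ x₁ m d (P·M) (D ∘ (0 1)) ↔ valueClassLabel σ ϖ x₁ x₀ m d M D` — `y ∈ P·M ↔ y ∘ (0 1) ∈ M` (★ `mem_mapGL_perm_iff`), and the binary norm form
`D₀x₀N(y₀) + D₁x₁N(y₁)` read at `(D ∘ (0 1), y)` is the form with `x₀ ↔ x₁` read at `(D, y ∘ (0 1))`; the reference set `valueSetMod σ ϖ m (xPlus σ ϖ d)` does not see the slots.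
[cite: Rogawski1990, §4.9 Prop. 4.9.1 (b) p. 55] [cite: Kottwitz1986BaseChangeUnits, §1 pp. 240–241] -/
theorem valueClassLabel_mapGL_swap01_iff (σ : K →+* K) (ϖ x₀ x₁ : K) (m d : ℕ) (P : GL (Fin 3) K)
    (hP : (P : Matrix (Fin 3) (Fin 3) K) = (Equiv.swap (0 : Fin 3) 1).permMatrix K) (M : Submodule 𝒪[K] (Fin 3 → K)) (D : Fin 3 → K) :
    valueClassLabel σ ϖ x₀ x₁ m d (mapGL P M) (D ∘ ⇑(Equiv.swap (0 : Fin 3) 1)) ↔ valueClassLabel σ ϖ x₁ x₀ m d M D := by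
  have hsymm : (Equiv.swap (0 : Fin 3) 1).symm = Equiv.swap (0 : Fin 3) 1 := Equiv.symm_swap _ _
  have hset : {v : K | ∃ y ∈ mapGL P M, Valued.v ((ϖ ^ m)⁻¹ * (v -
        ((D ∘ ⇑(Equiv.swap (0 : Fin 3) 1)) 0 * x₀ * (y 0 * σ (y 0)) + (D ∘ ⇑(Equiv.swap (0 : Fin 3) 1)) 1 * x₁ * (y 1 * σ (y 1))))) ≤ 1} =
      {v : K | ∃ y ∈ M, Valued.v ((ϖ ^ m)⁻¹ * (v - (D 0 * x₁ * (y 0 * σ (y 0)) + D 1 * x₀ * (y 1 * σ (y 1))))) ≤ 1} := by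
    ext v
    simp only [Set.mem_setOf_eq]
    constructor
    · rintro ⟨y, hy, hv⟩
      refine ⟨y ∘ ⇑(Equiv.swap (0 : Fin 3) 1).symm, (mem_mapGL_perm_iff P hP M y).1 hy, ?_⟩
      have ey : y = (y ∘ ⇑(Equiv.swap (0 : Fin 3) 1).symm) ∘ ⇑(Equiv.swap (0 : Fin 3) 1) := by
        rw [Function.comp_assoc, Equiv.symm_comp_self, Function.comp_id]
      rw [← binaryNormForm_comp_swap01 σ x₀ x₁ D (y ∘ ⇑(Equiv.swap (0 : Fin 3) 1).symm), ← ey]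
      exact hv
    · rintro ⟨y', hy', hv⟩
      refine ⟨y' ∘ ⇑(Equiv.swap (0 : Fin 3) 1), (mem_mapGL_perm_iff P hP M _).2 ?_, ?_⟩
      · rw [Function.comp_assoc, Equiv.self_comp_symm, Function.comp_id]
        exact hy'
      · rw [binaryNormForm_comp_swap01 σ x₀ x₁ D y']
        exact hv
  rw [valueClassLabel_iff, valueClassLabel_iff, hset]

/-- The functional form: `(fun M D ↦ valueClassLabel σ ϖ x₀ x₁ m d (P·M) (D ∘ (0 1))) = valueClassLabel σ ϖ x₁ x₀ m d` — the transported label of §2 at `π = (0 1)` IS the label of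
record with its two slots exchanged. [cite: Rogawski1990, §4.9 Prop. 4.9.1 (b) p. 55] -/
theorem valueClassLabel_mapGL_swap01_eq (σ : K →+* K) (ϖ x₀ x₁ : K) (m d : ℕ) (P : GL (Fin 3) K)
    (hP : (P : Matrix (Fin 3) (Fin 3) K) = (Equiv.swap (0 : Fin 3) 1).permMatrix K) :
    (fun (M' : Submodule 𝒪[K] (Fin 3 → K)) (D : Fin 3 → K) => valueClassLabel σ ϖ x₀ x₁ m d (mapGL P M') (D ∘ ⇑(Equiv.swap (0 : Fin 3) 1))) =
      valueClassLabel σ ϖ x₁ x₀ m d := by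
  funext M' D
  exact propext (valueClassLabel_mapGL_swap01_iff σ ϖ x₀ x₁ m d P hP M' D)

end Label

/-! ## §4  HEADS — the clean-shell-cut labelled-odd stratum sums under a coordinate permutation; the swap `(0 1)`; the element-datum adapter -/

section Heads

variable {K : Type} [Field K] [Valued K ℤᵐ⁰]

/-- `P · {M ∈ stratum(P⁻¹TP, a∘π⁻¹) : shell(e∘π⁻¹, e₂∘π⁻¹)} = {M ∈ stratum(T, a) : shell(e, e₂)}` for the three-token shell `diag(e)M ⊆ ϖ^ℓM ∧ diag(e)M ⊄ ϖ^{ℓ′}M ∧ diag(e₂)M ⊆ ϖ^{mc}M`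
(★ `image_mapGL_stratum` + ★ p859291 `latticeInLevel_diagonal_mapGL_perm_iff`). [cite: Kottwitz1986BaseChangeUnits, §1 pp. 240–241] -/
theorem image_mapGL_stratum_sep_shell (σ : K →+* K) (ϖ : K) {π : Equiv.Perm (Fin 3)} (P : GL (Fin 3) K)
    (hP : (P : Matrix (Fin 3) (Fin 3) K) = π.permMatrix K) (T : GL (Fin 3) K) (a : Fin 3 → ℕ) (ℓ ℓ' mc : ℕ) (e e₂ : Fin 3 → K) :
    mapGL P '' {M : Submodule 𝒪[K] (Fin 3 → K) | M ∈ stratum σ ϖ (P⁻¹ * T * P) (a ∘ ⇑π.symm) ∧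
        (LatticeInLevel ϖ ℓ (Matrix.diagonal (e ∘ ⇑π.symm)) M ∧ ¬ LatticeInLevel ϖ ℓ' (Matrix.diagonal (e ∘ ⇑π.symm)) M ∧
          LatticeInLevel ϖ mc (Matrix.diagonal (e₂ ∘ ⇑π.symm)) M)} =
      {M : Submodule 𝒪[K] (Fin 3 → K) | M ∈ stratum σ ϖ T a ∧
        (LatticeInLevel ϖ ℓ (Matrix.diagonal e) M ∧ ¬ LatticeInLevel ϖ ℓ' (Matrix.diagonal e) M ∧ LatticeInLevel ϖ mc (Matrix.diagonal e₂) M)} := by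
  have himg := image_mapGL_stratum σ ϖ P hP T a
  ext M'
  constructor
  · rintro ⟨M, ⟨hM, h1, h2, h3⟩, rfl⟩
    have hs : mapGL P M ∈ stratum σ ϖ T a := by rw [← himg]; exact ⟨M, hM, rfl⟩
    exact ⟨hs, (latticeInLevel_diagonal_mapGL_perm_iff P hP ϖ ℓ e M).2 h1, fun h => h2 ((latticeInLevel_diagonal_mapGL_perm_iff P hP ϖ ℓ' e M).1 h),
      (latticeInLevel_diagonal_mapGL_perm_iff P hP ϖ mc e₂ M).2 h3⟩
  · rintro ⟨hM', h1, h2, h3⟩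
    have hs : M' ∈ mapGL P '' stratum σ ϖ (P⁻¹ * T * P) (a ∘ ⇑π.symm) := by rw [himg]; exact hM'
    obtain ⟨M, hM, rfl⟩ := hs
    exact ⟨M, ⟨hM, (latticeInLevel_diagonal_mapGL_perm_iff P hP ϖ ℓ e M).1 h1, fun h => h2 ((latticeInLevel_diagonal_mapGL_perm_iff P hP ϖ ℓ' e M).2 h),
      (latticeInLevel_diagonal_mapGL_perm_iff P hP ϖ mc e₂ M).1 h3⟩, rfl⟩

/-- **HEAD (any `π`, any label) — THE SHELL-CUT LABELLED-ODD STRATUM SUM UNDER A COORDINATE PERMUTATION**: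
`Σᶠ_{M ∈ stratum(T,a), shell(e,e₂)} m^Λ_i(M) ∕ [𝒰 : N(S̃(M))] = Σᶠ_{M ∈ stratum(P⁻¹TP, a∘π⁻¹), shell(e∘π⁻¹, e₂∘π⁻¹)} m^{Λ∘P}_{π i}(M) ∕ [𝒰 : N(S̃(M))]`, `(Λ∘P) M′ D = Λ (P·M′) (D ∘ π)`
(for `T = diag(t)`, `P⁻¹TP = diag(t ∘ π⁻¹)` by ★ `coe_conj_eq_diagonal`). [cite: Kottwitz1986BaseChangeUnits, §1 pp. 240–241] [cite: Rogawski1990, §4.9 Prop. 4.9.1 (a)(b) p. 55] -/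
theorem finsum_stratum_shell_labelledOdd_div_relIndex_perm (σ : K →+* K) (ϖ : K) {π : Equiv.Perm (Fin 3)} (P : GL (Fin 3) K)
    (hP : (P : Matrix (Fin 3) (Fin 3) K) = π.permMatrix K) (T : GL (Fin 3) K) (a : Fin 3 → ℕ) (tv : ℕ) (i : Fin 3)
    (Λ : Submodule 𝒪[K] (Fin 3 → K) → (Fin 3 → K) → Prop) (ℓ ℓ' mc : ℕ) (e e₂ : Fin 3 → K) :
    ∑ᶠ M ∈ {M : Submodule 𝒪[K] (Fin 3 → K) | M ∈ stratum σ ϖ T a ∧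
        (LatticeInLevel ϖ ℓ (Matrix.diagonal e) M ∧ ¬ LatticeInLevel ϖ ℓ' (Matrix.diagonal e) M ∧ LatticeInLevel ϖ mc (Matrix.diagonal e₂) M)},
      (labelledOddCount σ ϖ tv i Λ M : ℚ) / ((((unitStabilizer M).map (unitNormMap σ 3)).relIndex (fixedUnitTorus σ 3) : ℕ) : ℚ) =
    ∑ᶠ M ∈ {M : Submodule 𝒪[K] (Fin 3 → K) | M ∈ stratum σ ϖ (P⁻¹ * T * P) (a ∘ ⇑π.symm) ∧
        (LatticeInLevel ϖ ℓ (Matrix.diagonal (e ∘ ⇑π.symm)) M ∧ ¬ LatticeInLevel ϖ ℓ' (Matrix.diagonal (e ∘ ⇑π.symm)) M ∧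
          LatticeInLevel ϖ mc (Matrix.diagonal (e₂ ∘ ⇑π.symm)) M)},
      (labelledOddCount σ ϖ tv (π i) (fun M' D => Λ (mapGL P M') (D ∘ ⇑π)) M : ℚ) /
        ((((unitStabilizer M).map (unitNormMap σ 3)).relIndex (fixedUnitTorus σ 3) : ℕ) : ℚ) := by
  rw [← image_mapGL_stratum_sep_shell σ ϖ P hP T a ℓ ℓ' mc e e₂, finsum_mem_image (mapGL_injective P).injOn]
  exact finsum_mem_congr rfl fun M _ => labelledOddCount_div_relIndex_mapGL_perm σ ϖ P hP tv i Λ M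

/-- **HEAD (the swap `(0 1)`) — THE COMMON-SHAPE SUM OF THE (β) TABLE IS `(0 1)`-COVARIANT**: for `T = diag(t₀, t₁, t₂)` and any `T′` with matrix `diag(t₁, t₀, t₂)`,
`Σᶠ_{M ∈ stratum(T, (a₀,a₁,a₂)), shell((e₀,e₁,e₂), (f₀,f₁,f₂))} m^{Λ(x₀,x₁)}_i(M) ∕ [𝒰 : N(S̃(M))] = Σᶠ_{M ∈ stratum(T′, (a₁,a₀,a₂)), shell((e₁,e₀,e₂), (f₁,f₀,f₂))} m^{Λ(x₁,x₀)}_{(01)i}(M) ∕ [𝒰 : N(S̃(M))]`,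
`Λ(x₀,x₁) = valueClassLabel σ ϖ x₀ x₁ m d` (§3: the transported label is the label with its slots exchanged).  At an element datum: `(α, β; n₁, n₂, n₃) ↦ (β, α; n₂, n₁, n₃)`, label
`(α−1, β−1) ↦ (β−1, α−1)`, shell tokens likewise. [cite: Kottwitz1986BaseChangeUnits, §1 pp. 240–241] [cite: Rogawski1990, §4.9 Prop. 4.9.1 (a)(b) p. 55] [cite: LanglandsShelstad1987, §3] -/
theorem finsum_stratum_shell_labelledOdd_div_relIndex_swap01 (σ : K →+* K) (ϖ x₀ x₁ : K) (m d tv : ℕ) (T T' : GL (Fin 3) K) {t₀ t₁ t₂ : K}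
    (hT : (T : Matrix (Fin 3) (Fin 3) K) = Matrix.diagonal ![t₀, t₁, t₂]) (hT' : (T' : Matrix (Fin 3) (Fin 3) K) = Matrix.diagonal ![t₁, t₀, t₂])
    (a₀ a₁ a₂ ℓ ℓ' mc : ℕ) (e₀ e₁ e₂ f₀ f₁ f₂ : K) (i : Fin 3) :
    ∑ᶠ M ∈ {M : Submodule 𝒪[K] (Fin 3 → K) | M ∈ stratum σ ϖ T ![a₀, a₁, a₂] ∧
        (LatticeInLevel ϖ ℓ (Matrix.diagonal ![e₀, e₁, e₂]) M ∧ ¬ LatticeInLevel ϖ ℓ' (Matrix.diagonal ![e₀, e₁, e₂]) M ∧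
          LatticeInLevel ϖ mc (Matrix.diagonal ![f₀, f₁, f₂]) M)},
      (labelledOddCount σ ϖ tv i (valueClassLabel σ ϖ x₀ x₁ m d) M : ℚ) / ((((unitStabilizer M).map (unitNormMap σ 3)).relIndex (fixedUnitTorus σ 3) : ℕ) : ℚ) =
    ∑ᶠ M ∈ {M : Submodule 𝒪[K] (Fin 3 → K) | M ∈ stratum σ ϖ T' ![a₁, a₀, a₂] ∧
        (LatticeInLevel ϖ ℓ (Matrix.diagonal ![e₁, e₀, e₂]) M ∧ ¬ LatticeInLevel ϖ ℓ' (Matrix.diagonal ![e₁, e₀, e₂]) M ∧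
          LatticeInLevel ϖ mc (Matrix.diagonal ![f₁, f₀, f₂]) M)},
      (labelledOddCount σ ϖ tv (Equiv.swap (0 : Fin 3) 1 i) (valueClassLabel σ ϖ x₁ x₀ m d) M : ℚ) /
        ((((unitStabilizer M).map (unitNormMap σ 3)).relIndex (fixedUnitTorus σ 3) : ℕ) : ℚ) := by
  obtain ⟨P, hP⟩ := exists_gl_coe_eq_permMatrix (K := K) (Equiv.swap (0 : Fin 3) 1)
  rw [finsum_stratum_shell_labelledOdd_div_relIndex_perm σ ϖ P hP T _ tv i _ ℓ ℓ' mc, valueClassLabel_mapGL_swap01_eq σ ϖ x₀ x₁ m d P hP]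
  have ha : (![a₀, a₁, a₂] : Fin 3 → ℕ) ∘ ⇑(Equiv.swap (0 : Fin 3) 1).symm = ![a₁, a₀, a₂] := by
    ext j; fin_cases j <;> rfl
  have he : (![e₀, e₁, e₂] : Fin 3 → K) ∘ ⇑(Equiv.swap (0 : Fin 3) 1).symm = ![e₁, e₀, e₂] := by
    ext j; fin_cases j <;> rfl
  have hf : (![f₀, f₁, f₂] : Fin 3 → K) ∘ ⇑(Equiv.swap (0 : Fin 3) 1).symm = ![f₁, f₀, f₂] := by
    ext j; fin_cases j <;> rfl
  have hd : (![t₀, t₁, t₂] : Fin 3 → K) ∘ ⇑(Equiv.swap (0 : Fin 3) 1).symm = ![t₁, t₀, t₂] := by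
    ext j; fin_cases j <;> rfl
  have hTT : P⁻¹ * T * P = T' := Units.ext (by rw [coe_conj_eq_diagonal P hP T hT, hd, hT'])
  rw [ha, he, hf, hTT]

/-- **ADAPTER `(a,b,c) ↦ (b,a,c)` OVER AN ELEMENT DATUM — THE `(0 1)`-TWIN ROW BY APPLICATION.**  Suppose that at every element datum `(α′, β′; n₁′, n₂′, n₃′)` (threshold `N₀`),
`T′ = diag(α′, β′, 1)`, and every auxiliary witness `w` (e.g. a tower-sign token) satisfying `Hyp α′ β′ n₁′ n₂′ n₃′ w`, the common-shape sum over `stratum(T′, (a,b,c))` cut by the clean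
shell of `X′ = diag(α′−1, β′−1, 0)` (levels `ℓ`, `¬ℓ′`; squares at `mc`) with label `valueClassLabel σ ϖ (α′−1) (β′−1) m d` equals `F α′ β′ n₁′ n₂′ n₃′ w i` in slot `i`.  Then at a datum
`(α, β; n₁, n₂, n₃)` whose SWAPPED letters satisfy `Hyp β α n₂ n₁ n₃ w`, the same sum over `stratum(T, (b,a,c))` equals `F β α n₂ n₁ n₃ w ((0 1) i)` — ★ `isElementDatum_swap` and the
`(0 1)` head.  (R4 := R3 ∘ this; the `n₂`-cell half of R5 := ★ p861290 ∘ this.) [cite: Kottwitz1986BaseChangeUnits, §1 pp. 240–241] [cite: Rogawski1990, §4.9 Prop. 4.9.1 (a)(b) p. 55]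
[cite: LanglandsShelstad1987, §3] -/
theorem finsum_stratum_shell_labelledOdd_div_relIndex_swap01_of {σ : K →+* K} {ϖ : K} {α β : K} {N₀ n₁ n₂ n₃ : ℕ} {T : GL (Fin 3) K}
    (hE : IsElementDatum σ ϖ N₀ α β n₁ n₂ n₃) (hT : (T : Matrix (Fin 3) (Fin 3) K) = Matrix.diagonal ![α, β, 1]) (tv a b c ℓ ℓ' mc m d : ℕ) {W : Type*}
    (Hyp : K → K → ℕ → ℕ → ℕ → W → Prop) (F : K → K → ℕ → ℕ → ℕ → W → Fin 3 → ℚ)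
    (hG : ∀ {α' β' : K} {n₁' n₂' n₃' : ℕ} (T' : GL (Fin 3) K) (w : W), IsElementDatum σ ϖ N₀ α' β' n₁' n₂' n₃' →
      (T' : Matrix (Fin 3) (Fin 3) K) = Matrix.diagonal ![α', β', 1] → Hyp α' β' n₁' n₂' n₃' w →
        ∀ i : Fin 3, ∑ᶠ M ∈ {M : Submodule 𝒪[K] (Fin 3 → K) | M ∈ stratum σ ϖ T' ![a, b, c] ∧
            (LatticeInLevel ϖ ℓ (Matrix.diagonal ![α' - 1, β' - 1, 0]) M ∧ ¬ LatticeInLevel ϖ ℓ' (Matrix.diagonal ![α' - 1, β' - 1, 0]) M ∧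
              LatticeInLevel ϖ mc (Matrix.diagonal ![(α' - 1) * (α' - 1), (β' - 1) * (β' - 1), 0]) M)},
          (labelledOddCount σ ϖ tv i (valueClassLabel σ ϖ (α' - 1) (β' - 1) m d) M : ℚ) /
            ((((unitStabilizer M).map (unitNormMap σ 3)).relIndex (fixedUnitTorus σ 3) : ℕ) : ℚ) = F α' β' n₁' n₂' n₃' w i)
    (w : W) (hHyp : Hyp β α n₂ n₁ n₃ w) (i : Fin 3) :
    ∑ᶠ M ∈ {M : Submodule 𝒪[K] (Fin 3 → K) | M ∈ stratum σ ϖ T ![b, a, c] ∧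
        (LatticeInLevel ϖ ℓ (Matrix.diagonal ![α - 1, β - 1, 0]) M ∧ ¬ LatticeInLevel ϖ ℓ' (Matrix.diagonal ![α - 1, β - 1, 0]) M ∧
          LatticeInLevel ϖ mc (Matrix.diagonal ![(α - 1) * (α - 1), (β - 1) * (β - 1), 0]) M)},
      (labelledOddCount σ ϖ tv i (valueClassLabel σ ϖ (α - 1) (β - 1) m d) M : ℚ) /
        ((((unitStabilizer M).map (unitNormMap σ 3)).relIndex (fixedUnitTorus σ 3) : ℕ) : ℚ) = F β α n₂ n₁ n₃ w (Equiv.swap (0 : Fin 3) 1 i) := by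
  obtain ⟨P, hP⟩ := exists_gl_coe_eq_permMatrix (K := K) (Equiv.swap (0 : Fin 3) 1)
  have hd : (![α, β, 1] : Fin 3 → K) ∘ ⇑(Equiv.swap (0 : Fin 3) 1).symm = ![β, α, 1] := by
    ext j; fin_cases j <;> rfl
  have hT' : ((P⁻¹ * T * P : GL (Fin 3) K) : Matrix (Fin 3) (Fin 3) K) = Matrix.diagonal ![β, α, 1] := by rw [coe_conj_eq_diagonal P hP T hT, hd]
  rw [finsum_stratum_shell_labelledOdd_div_relIndex_swap01 σ ϖ (α - 1) (β - 1) m d tv T (P⁻¹ * T * P) hT hT' b a c ℓ ℓ' mc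
    (α - 1) (β - 1) 0 ((α - 1) * (α - 1)) ((β - 1) * (β - 1)) 0 i]
  exact hG _ w (isElementDatum_swap hE) hT' hHyp _

end Heads

end Summit.HodgeConjecture.HodgeConjecture.Cruxes.H413.F0P3cDyRamLabelledOddSwapEngine

end
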